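import Summits.AtomisticToContinuum.HydrodynamicLimit.Theorems.LightConeInLaw.Negative.HomogeneousWitness
import Summits.AtomisticToContinuum.HydrodynamicLimit.Theorems.RelayRaceLocalityLightConeInLawStubEquilibrium
import Summits.AtomisticToContinuum.HydrodynamicLimit.Theorems.RelayRaceLocalityNearConstantShortTimeHLStaticLLN
import Summits.AtomisticToContinuum.HydrodynamicLimit.Theorems.RelayRaceLocalityNearConstantShortTimeHLGeneralGibbs
import Literature.MathematicalPhysics.KineticTheory.HardSphereCanonicalTorus
import Literature.Analysis.FluidPDE.HardSphereAlexander
import Literature.MathematicalPhysics.KineticTheory.EvenCollisionTubeFunctional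

/-!
# `LightConeInLaw` (stmt-AtomisticToContinuum-12500): the REDUCED-DENSITY part of the agreement clause is
load-bearing — the eightfold comparison gas

Negative-side lemma for the crux `RelayRaceLocality.LightConeInLaw` (two-copy light cone in law), from the standing
disprover's `Cruxes/LightConeInLaw/Disproof.lean` §6 (cycle 2; the one clause of the load-bearing table that cycle 1
could not reach, "blocked by the diameter index"). WITNESS (no non-equilibrium dynamics, only theorems of the tree):
gas 1 is the homogeneous gas `(1, 0, 1)` of `N + 1` spheres at reduced diameter `σ`; gas 2 is the SAME homogeneous
profile `(1, 0, 1)` with EIGHT TIMES AS MANY spheres of the same diameter, `n₂ N = 8N + 8 = (8N+7) + 1` spheres of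
diameter `hsDiameter σ N = hsDiameter (2σ) (8N+7)`, i.e. reduced diameter `σ₂ = 2σ` (`n₂ ε³ = (2σ)³` identically).
Both canonical laws are probability measures (`posPartition_pos` at reduced diameter `2σ ≤ 1/2`), tied at `t = 0` to
the constant Euler states `(1, 0, 1)` (gas 1: `homogeneous_lln_all_times`; gas 2: the general-family exponential
concentration `NearConstantShortTimeHL.stub_concentrationGeneralFamilies` at the matched density `ρ ≡ 1`, the
activity constant dropping out of the canonical law), and flow-invariant (`Equilibrium.integral_comp_flow_particleLaw_const`,
every `(ε, n)`). The two gases agree everywhere in velocity (`0`) and temperature (`1`) but their REDUCED densities are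
`σ³` and `8σ³`: tested against a bump `χ` in `B(0, 1/8)` and the clipped first coordinate `F(p) = clip1 p.1`, the two
expectations converge to `σ³ ∫χ` and `8σ³ ∫χ` (`TimeZero.tendsto_integral_reducedTriple`), which differ since
`∫χ > 0`.

CONSEQUENCE (`lightConeInLaw_false_without_densityAgreement`): the crux VERBATIM with the conjunct
`ρ₁ 0 x * σ₁ ^ 3 = ρ₂ 0 x * σ₂ ^ 3` deleted from the agreement clause on `B(x₀, R)` is FALSE (witness above with
`M = 2`, `t = 1`, `x₀ = 0`, `R = c + 1/8`). Together with `HomogeneousWitness.lean` (thermal / velocity agreement,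
support clause, the two ties) and `IdealGas*.lean` (sign of the diameter) this completes the clause-by-clause
load-bearing table of the crux: every hypothesis that a homogeneous or collisionless witness can test is necessary.
§5 (`stubCone_false_without_densityAgreement`): the same witness is COMMENSURATE (`8N+8 = ⌈8(N+1)⌉₊`), so the clause is
load-bearing also for the line's weaker stub `stub_cone` (R2) of `Cruxes/LightConeInLaw/Lines/susceptibility_variance_continuity.lean`.
refuter-cdisprove-stmt-AtomisticToContinuum-12500-g2-0.
-/

noncomputable section

open MeasureTheory Filter Set Topology
open scoped ENNReal
open Literature.MathematicalPhysics.KineticTheory Literature.Analysis.FluidPDE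

namespace Summit.AtomisticToContinuum.HydrodynamicLimit.Theorems

namespace LightConeInLawNegative

open LightConeInLawSketch

/-! ### §1 The eightfold comparison family: `(8N+7)+1` spheres of diameter `hsDiameter σ N = hsDiameter (2σ) (8N+7)` -/

/-- The diameter of the conjunct family at `(σ, N)` is the diameter of the conjunct family at `(2σ, 8N+7)`:
`σ (N+1)^{-1/3} = 2σ (8N+8)^{-1/3}`. [folklore] -/
theorem hsDiameter_eightfold {σ : ℝ} (hσ : 0 < σ) (N : ℕ) :
    hsDiameter σ N = hsDiameter (2 * σ) (8 * N + 7) := by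
  have h1 : 0 < hsDiameter σ N := hsDiameter_pos hσ N
  have h2 : 0 < hsDiameter (2 * σ) (8 * N + 7) := hsDiameter_pos (by positivity) _
  refine (pow_left_inj₀ h1.le h2.le (by norm_num : (3 : ℕ) ≠ 0)).1 ?_
  rw [hsDiameter_pow_three, hsDiameter_pow_three]
  have hN : (0 : ℝ) < (N : ℝ) + 1 := by positivity
  push_cast
  field_simp
  ring

/-- The eightfold family has constant reduced volume `n₂ ε³ = (2σ)³`. [folklore] -/
theorem eightfold_mul_hsDiameter_pow_three (σ : ℝ) (N : ℕ) :
    ((8 * N + 7 + 1 : ℕ) : ℝ) * hsDiameter σ N ^ 3 = (2 * σ) ^ 3 := by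
  rw [hsDiameter_pow_three]
  have hN : (0 : ℝ) < (N : ℝ) + 1 := by positivity
  push_cast
  field_simp
  ring

/-- The eightfold family satisfies the crux's asymptotic condition towards `σ₂ = 2σ`. [folklore] -/
theorem tendsto_eightfold_mul_hsDiameter (σ : ℝ) :
    Tendsto (fun N : ℕ => ((8 * N + 7 + 1 : ℕ) : ℝ) * hsDiameter σ N ^ 3) atTop (𝓝 ((2 * σ) ^ 3)) := by
  rw [show (fun N : ℕ => ((8 * N + 7 + 1 : ℕ) : ℝ) * hsDiameter σ N ^ 3) = fun _ => (2 * σ) ^ 3 from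
    funext fun N => eightfold_mul_hsDiameter_pow_three σ N]
  exact tendsto_const_nhds

/-- **The eightfold canonical laws are probability measures for every `N`** (`σ ≤ 1/4`): the configurational
partition function is that of the conjunct family at reduced diameter `2σ ≤ 1/2` (`posPartition_pos`). [folklore] -/
theorem isProb_eightLaw {σ : ℝ} (hσ : 0 < σ) (hσ4 : σ ≤ 1 / 4) (N : ℕ)
    (Ψ : HardSphereFlow G3 (hsDiameter σ N) (8 * N + 7 + 1)) : IsProbabilityMeasure
      (particleLaw Ψ (canonicalDensity G3 (hsDiameter σ N) (8 * N + 7 + 1)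
      (localGibbsProfile (fun _ : T3 => (1 : ℝ)) (fun _ : T3 => (0 : V3)) (fun _ : T3 => (1 : ℝ))))) := by
  have hZ : 0 < posPartition (fun _ : T3 => (1 : ℝ)) (hsDiameter σ N) (8 * N + 7 + 1) := by
    rw [hsDiameter_eightfold hσ N]
    exact posPartition_pos continuous_const (fun _ => one_pos) (by linarith) (8 * N + 7)
  rw [particleLaw_eq, NearConstantShortTimeHL.liouville_withDensity_canonicalDensity]
  exact NearConstantShortTimeHL.isProbabilityMeasure_canonicalLaw measurable_const measurable_const
    measurable_const (fun _ => zero_le_one) (fun _ => le_rfl) (fun _ => one_pos) hZ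

/-- Flows of the eightfold family exist (Alexander's theorem on the torus, `ε < 1/2`). [folklore] -/
theorem eightFlows_nonempty {σ : ℝ} (hσ : 0 < σ) (hσ2 : σ < 1 / 2) :
    Nonempty ((N : ℕ) → HardSphereFlow G3 (hsDiameter σ N) (8 * N + 7 + 1)) :=
  ⟨fun N => Classical.choice
    ((show ∀ {ε : ℝ}, 0 < ε → ε < 2⁻¹ → ∀ n : ℕ, Nonempty (HardSphereFlow (Torus.geometry (Fin 3)) ε n) from
      HardSphereFlow.nonempty_torus_holds) (hsDiameter_pos hσ N)
      ((hsDiameter_le hσ.le N).trans_lt (hσ2.trans_eq (by norm_num))) (8 * N + 7 + 1))⟩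

/-- **Law of large numbers at flow-time `0` for the homogeneous eightfold gas**, towards the constant state
`(1, 0, 1)`: the general-family exponential concentration `stub_concentrationGeneralFamilies` at matched density
`ρ ≡ 1` and reduced diameter `2σ` (its activity is the constant `e^{g(1)}`, which drops out of the canonical law,
`canonicalDensity_const_mul`), `n₂ N → ∞`, and `Φ₀ = id` almost surely (`measure_setOf_flow_zero_mem`).
[cite: PulvirentiTsagkarogiannis2012, Thm 2.1] -/
theorem eightLaw_lln_zero :
    ∃ σ₁ : ℝ, 0 < σ₁ ∧ ∀ σ : ℝ, 0 < σ → σ < σ₁ →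
      ∀ Ψ : (N : ℕ) → HardSphereFlow G3 (hsDiameter σ N) (8 * N + 7 + 1),
        LLNAt (fun N => 8 * N + 7 + 1) (fun N => particleLaw (Ψ N) (canonicalDensity G3 (hsDiameter σ N) (8 * N + 7 + 1)
      (localGibbsProfile (fun _ : T3 => (1 : ℝ)) (fun _ : T3 => (0 : V3)) (fun _ : T3 => (1 : ℝ))))) Ψ
          (fun _ => (1 : ℝ)) (fun _ => (0 : V3)) (fun _ => (1 : ℝ)) 0 := by
  obtain ⟨η₁, hη₁, H2⟩ := NearConstantShortTimeHL.stub_concentrationGeneralFamilies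
  refine ⟨min 1 (η₁ / 8), lt_min one_pos (by positivity), fun σ hσ hσ₁ Ψ => ?_⟩
  have hσ1 : σ ≤ 1 := (hσ₁.trans_le (min_le_left _ _)).le
  have hση : σ ≤ η₁ / 8 := (hσ₁.trans_le (min_le_right _ _)).le
  have hσ3 : σ ^ 3 ≤ σ := by
    have h : σ ^ 2 ≤ 1 := by nlinarith
    nlinarith
  have h8 : (1 : ℝ) * (2 * σ) ^ 3 ≤ η₁ := by nlinarith
  set g : ℝ → ℝ := fun r => hsExcessFreeEnergy (r * (2 * σ) ^ 3) +
    r * (2 * σ) ^ 3 * deriv hsExcessFreeEnergy (r * (2 * σ) ^ 3) with hgdef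
  have hmass : ∫ x : T3, (fun _ : T3 => (1 : ℝ)) x = 1 := by simp
  have hS := H2 (2 * σ) (by positivity) 1 one_pos (fun _ => (1 : ℝ)) continuous_const
    (fun _ => ⟨le_rfl, h8⟩) hmass (fun _ => (0 : V3)) (fun _ => (1 : ℝ)) continuous_const continuous_const
    (fun _ => one_pos) (fun N => hsDiameter σ N) (fun N => 8 * N + 7 + 1) (fun N => hsDiameter_pos hσ N)
    (tendsto_hsDiameter σ) (tendsto_eightfold_mul_hsDiameter σ)
  -- the activity constant `e^{g(1)}` drops out of the canonical law
  have hA0 : Real.exp (g 1) ≠ 0 := (Real.exp_pos _).ne'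
  have hcd : ∀ N, canonicalDensity G3 (hsDiameter σ N) (8 * N + 7 + 1)
      (localGibbsProfile (fun _ => (1 : ℝ)) (fun _ => (0 : V3)) (fun _ => (1 : ℝ))) =
      canonicalDensity G3 (hsDiameter σ N) (8 * N + 7 + 1)
      (localGibbsProfile (fun _ : T3 => (1 : ℝ) * Real.exp (g 1)) (fun _ => (0 : V3)) (fun _ => (1 : ℝ))) := by
    intro N
    have hfun : (fun _ : T3 => (1 : ℝ) * Real.exp (g 1)) =
        fun x => Real.exp (g 1) * (fun _ : T3 => (1 : ℝ)) x := by
      funext x; ring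
    rw [hfun, MacroClosureLine.StubLedger.localGibbsProfile_const_mul]
    funext z
    exact (KineticWindowGronwallNegative.canonicalDensity_const_mul hA0 _ _ z).symm
  have hn_top : Tendsto (fun N : ℕ => 8 * N + 7 + 1) atTop atTop :=
    tendsto_atTop_atTop.2 fun b => ⟨b, fun N hN => by omega⟩
  have hac : ∀ N, particleLaw (Ψ N) (canonicalDensity G3 (hsDiameter σ N) (8 * N + 7 + 1)
      (localGibbsProfile (fun _ : T3 => (1 : ℝ)) (fun _ : T3 => (0 : V3)) (fun _ : T3 => (1 : ℝ)))) ≪ liouville G3 (8 * N + 7 + 1) (hsDiameter σ N) := fun N =>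
    withDensity_absolutelyContinuous _ _
  intro χ hχ δ hδ
  obtain ⟨C, hC, hCN⟩ := hS χ hχ δ hδ
  refine ⟨NearConstantShortTimeHL.tendsto_zero_of_le_exp hn_top hC fun N => ?_,
    NearConstantShortTimeHL.tendsto_zero_of_le_exp hn_top hC fun N => ?_,
    NearConstantShortTimeHL.tendsto_zero_of_le_exp hn_top hC fun N => ?_⟩
  · refine (NearConstantShortTimeHL.measure_setOf_flow_zero_mem (Ψ N) (hac N)
      {z | δ < |empiricalDensityField z χ - ∫ x, χ x * (fun _ : T3 => (1 : ℝ)) x|}).le.trans ?_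
    rw [hcd N]
    exact (hCN N).1
  · refine (NearConstantShortTimeHL.measure_setOf_flow_zero_mem (Ψ N) (hac N)
      {z | δ < ‖empiricalMomentumField z χ -
        ∫ x, (χ x * (fun _ : T3 => (1 : ℝ)) x) • (fun _ : T3 => (0 : V3)) x‖}).le.trans ?_
    rw [hcd N]
    exact (hCN N).2.1
  · refine (NearConstantShortTimeHL.measure_setOf_flow_zero_mem (Ψ N) (hac N)
      {z | δ < |empiricalEnergyField z χ - ∫ x, χ x * totalEnergyDensity ((fun _ : T3 => (1 : ℝ)) x)
        ((fun _ : T3 => (0 : V3)) x) ((fun _ : T3 => (1 : ℝ)) x)|}).le.trans ?_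
    rw [hcd N]
    exact (hCN N).2.2

/-! ### §2 The test function: a bump of radius `1/8` around `0 ∈ 𝕋³` -/

/-- **A test function for the cone**: a continuous `χ : 𝕋³ → [0, 1/8]` with positive integral vanishing off the
ball `B(0, 1/8)` — the bump `χ(x) = max(0, 1/8 - dist(x, 0))` (`dist(x, 0) = ‖reprSym x‖`; Haar measure charges the
open set `{χ > 0}`). [folklore] -/
theorem exists_coneBump : ∃ χ : T3 → ℝ, Continuous χ ∧ (∀ x, 0 ≤ χ x) ∧ (∀ x, χ x ≤ 1 / 8) ∧
    (0 < ∫ x, χ x) ∧ ∀ x, 1 / 8 ≤ Torus.euclidDist x 0 → χ x = 0 := by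
  have hdist : ∀ x : T3, Torus.euclidDist x 0 = ‖Torus.reprSym x‖ := fun x => by
    rw [Torus.euclidDist_eq, sub_zero]
  have hcont : Continuous fun x : T3 => max 0 (1 / 8 - ‖Torus.reprSym x‖) :=
    continuous_const.max (continuous_const.sub Torus.continuous_norm_reprSym)
  have h0 : ∀ x : T3, 0 ≤ max 0 (1 / 8 - ‖Torus.reprSym x‖) := fun x => le_max_left _ _
  have hzero : max 0 (1 / 8 - ‖Torus.reprSym (0 : T3)‖) ≠ 0 := by
    rw [← hdist, Torus.euclidDist_self]; norm_num
  refine ⟨fun x => max 0 (1 / 8 - ‖Torus.reprSym x‖), hcont, h0,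
    fun x => max_le (by norm_num) (by linarith [norm_nonneg (Torus.reprSym x)]),
    hcont.integral_pos_of_hasCompactSupport_nonneg_nonzero (HasCompactSupport.of_compactSpace _) h0 hzero,
    fun x hx => ?_⟩
  rw [hdist] at hx
  exact max_eq_left (by linarith)

/-! ### §3 Non-merging of the homogeneous gas and its eightfold copy -/

/-- The tree's coordinate clip `clip1 x = max (min x 1) (-1)` (`EvenCollisionTubeFunctional`) is `1`-Lipschitz.
[folklore] -/
theorem lipschitz_clip1 : LipschitzWith 1 clip1 := (LipschitzWith.id.min_const 1).max_const (-1)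

/-- The clip is the identity on `[0, 1]`. [folklore] -/
theorem clip1_of_mem {x : ℝ} (hx0 : 0 ≤ x) (hx1 : x ≤ 1) : clip1 x = x :=
  clip1_eq_self (abs_le.2 ⟨by linarith, hx1⟩)

/-- The functional `F(p) = clip p.1` of the reduced triple is `1`-Lipschitz (sup metric). [folklore] -/
theorem lipschitz_clip1_fst : LipschitzWith 1 (fun p : ℝ × V3 × ℝ => clip1 p.1) := by
  have h1 := lipschitz_clip1.comp (LipschitzWith.prod_fst (α := ℝ) (β := V3 × ℝ))
  rw [mul_one] at h1
  exact h1

/-- `σ³ B ≠ 8 σ³ B` for `σ, B > 0`, in the shape produced by the limits. [folklore] -/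
theorem seven_sigma_cube_ne {σ B : ℝ} (hσ : 0 < σ) (hB : 0 < B)
    (h : (0 : ℝ) = σ ^ 3 * B - (2 * σ) ^ 3 * B) : False := by
  have h3 : 0 < σ ^ 3 * B := mul_pos (pow_pos hσ 3) hB
  nlinarith

/-- **The homogeneous gas `(1,0,1)` at reduced diameter `σ` and its eightfold version (reduced diameter `2σ`) do
NOT merge in the bounded-Lipschitz sense at time `1`**, tested against any continuous `χ ≤ 1/8` with `∫χ > 0`.
Given the laws of large numbers (gas 1 at time `1`; gas 2 at flow-time `0`, transported to time `1` by stationarity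
of the homogeneous canonical law, `Equilibrium.integral_comp_flow_particleLaw_const`), the expectations of
`F = clip ∘ fst` converge to `σ³ ∫χ` and `8σ³ ∫χ` (`TimeZero.tendsto_integral_reducedTriple`, `clip = id` on `[0, 1]`),
so their difference does not tend to `0`. [folklore] -/
theorem eight_not_merging {σ : ℝ} (hσ : 0 < σ) (hσ4 : σ ≤ 1 / 4) {χ : T3 → ℝ} (hχ : Continuous χ)
    (hχ8 : ∀ x, χ x ≤ 1 / 8) (hB0 : 0 < ∫ x, χ x)
    (Φ₁ : (N : ℕ) → HardSphereFlow G3 (hsDiameter σ N) (N + 1))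
    (Φ₂ : (N : ℕ) → HardSphereFlow G3 (hsDiameter σ N) (8 * N + 7 + 1))
    (hP₁ : ∀ N, IsProbabilityMeasure
      (localGibbsLaw σ (fun _ => (1 : ℝ)) (fun _ => (0 : V3)) (fun _ => (1 : ℝ)) N (Φ₁ N)))
    (hP₂ : ∀ N, IsProbabilityMeasure (particleLaw (Φ₂ N) (canonicalDensity G3 (hsDiameter σ N) (8 * N + 7 + 1)
      (localGibbsProfile (fun _ : T3 => (1 : ℝ)) (fun _ : T3 => (0 : V3)) (fun _ : T3 => (1 : ℝ))))))
    (hL₁ : LLNAt (fun N => N + 1)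
      (fun N => localGibbsLaw σ (fun _ => (1 : ℝ)) (fun _ => (0 : V3)) (fun _ => (1 : ℝ)) N (Φ₁ N)) Φ₁
      (fun _ => (1 : ℝ)) (fun _ => (0 : V3)) (fun _ => (1 : ℝ)) 1)
    (hL₂ : LLNAt (fun N => 8 * N + 7 + 1) (fun N => particleLaw (Φ₂ N) (canonicalDensity G3 (hsDiameter σ N) (8 * N + 7 + 1)
      (localGibbsProfile (fun _ : T3 => (1 : ℝ)) (fun _ : T3 => (0 : V3)) (fun _ : T3 => (1 : ℝ))))) Φ₂
      (fun _ => (1 : ℝ)) (fun _ => (0 : V3)) (fun _ => (1 : ℝ)) 0) :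
    ¬ (∀ F : ℝ × V3 × ℝ → ℝ, LipschitzWith 1 F → (∀ p, |F p| ≤ 1) →
        Tendsto (fun N =>
          (∫ z, F (σ ^ 3 * empiricalDensityField ((Φ₁ N).flow 1 z) χ,
              (σ ^ 3) • empiricalMomentumField ((Φ₁ N).flow 1 z) χ,
              σ ^ 3 * empiricalEnergyField ((Φ₁ N).flow 1 z) χ)
            ∂(localGibbsLaw σ (fun _ => (1 : ℝ)) (fun _ => (0 : V3)) (fun _ => (1 : ℝ)) N (Φ₁ N))) -
          ∫ z, F ((2 * σ) ^ 3 * empiricalDensityField ((Φ₂ N).flow 1 z) χ,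
              ((2 * σ) ^ 3) • empiricalMomentumField ((Φ₂ N).flow 1 z) χ,
              (2 * σ) ^ 3 * empiricalEnergyField ((Φ₂ N).flow 1 z) χ)
            ∂(particleLaw (Φ₂ N) (canonicalDensity G3 (hsDiameter σ N) (8 * N + 7 + 1)
      (localGibbsProfile (fun _ : T3 => (1 : ℝ)) (fun _ : T3 => (0 : V3)) (fun _ : T3 => (1 : ℝ)))))) atTop (𝓝 0)) := by
  intro hmerge
  have h2σ : 0 < 2 * σ := by positivity
  have hF := lipschitz_clip1_fst
  have hFb : ∀ p : ℝ × V3 × ℝ, |(fun p : ℝ × V3 × ℝ => clip1 p.1) p| ≤ 1 := fun p => abs_clip1_le p.1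
  -- gas 1: the limit of its expectation at time `1`
  have lim₁ := TimeZero.tendsto_integral_reducedTriple _ hP₁ Φ₁ (fun _ => (1 : ℝ)) (fun _ => (1 : ℝ))
    (fun _ => (0 : V3)) 1 hL₁ hσ hχ _ hF hFb
  -- gas 2: stationarity of the homogeneous canonical law reduces time `1` to time `0`
  have lim₂0 := TimeZero.tendsto_integral_reducedTriple _ hP₂ Φ₂ (fun _ => (1 : ℝ)) (fun _ => (1 : ℝ))
    (fun _ => (0 : V3)) 0 hL₂ h2σ hχ _ hF hFb
  have hG : ∀ N, Measurable fun w : Config (8 * N + 7 + 1) (Fin 3) T3 =>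
      (fun p : ℝ × V3 × ℝ => clip1 p.1) ((2 * σ) ^ 3 * empiricalDensityField w χ,
        ((2 * σ) ^ 3) • empiricalMomentumField w χ, (2 * σ) ^ 3 * empiricalEnergyField w χ) := fun N =>
    Equilibrium.measurable_comp_reducedTriple (2 * σ) hχ hF.continuous
  have key₂ : ∀ N,
      ∫ z, (fun p : ℝ × V3 × ℝ => clip1 p.1) ((2 * σ) ^ 3 * empiricalDensityField ((Φ₂ N).flow 1 z) χ,
          ((2 * σ) ^ 3) • empiricalMomentumField ((Φ₂ N).flow 1 z) χ,
          (2 * σ) ^ 3 * empiricalEnergyField ((Φ₂ N).flow 1 z) χ) ∂(particleLaw (Φ₂ N) (canonicalDensity G3 (hsDiameter σ N) (8 * N + 7 + 1)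
      (localGibbsProfile (fun _ : T3 => (1 : ℝ)) (fun _ : T3 => (0 : V3)) (fun _ : T3 => (1 : ℝ))))) =
      ∫ z, (fun p : ℝ × V3 × ℝ => clip1 p.1) ((2 * σ) ^ 3 * empiricalDensityField ((Φ₂ N).flow 0 z) χ,
          ((2 * σ) ^ 3) • empiricalMomentumField ((Φ₂ N).flow 0 z) χ,
          (2 * σ) ^ 3 * empiricalEnergyField ((Φ₂ N).flow 0 z) χ) ∂(particleLaw (Φ₂ N) (canonicalDensity G3 (hsDiameter σ N) (8 * N + 7 + 1)
      (localGibbsProfile (fun _ : T3 => (1 : ℝ)) (fun _ : T3 => (0 : V3)) (fun _ : T3 => (1 : ℝ))))) := fun N =>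
    (Equilibrium.integral_comp_flow_particleLaw_const 1 1 0 (Φ₂ N) 1 (hG N).aestronglyMeasurable).trans
      (Equilibrium.integral_comp_flow_particleLaw_const 1 1 0 (Φ₂ N) 0 (hG N).aestronglyMeasurable).symm
  have lim₂ := lim₂0.congr fun N => (key₂ N).symm
  -- the two limits of the difference
  have heq := tendsto_nhds_unique (hmerge _ hF hFb) (lim₁.sub lim₂)
  have hI : (∫ x, χ x * (fun _ : T3 => (1 : ℝ)) x) = ∫ x, χ x := by simp
  have hB1 : ∫ x, χ x ≤ 1 / 8 := by
    have h := integral_mono (integrable_of_continuous_T3 hχ) (integrable_const (1 / 8 : ℝ)) hχ8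
    simpa using h
  have hσ364 : σ ^ 3 ≤ 1 / 64 := by
    have h := pow_le_pow_left₀ hσ.le hσ4 3
    norm_num at h
    exact h
  have hb0 : 0 ≤ σ ^ 3 * ∫ x, χ x := by positivity
  have hb1 : σ ^ 3 * ∫ x, χ x ≤ 1 := by
    calc σ ^ 3 * ∫ x, χ x ≤ (1 / 64) * (1 / 8) := mul_le_mul hσ364 hB1 hB0.le (by norm_num)
      _ ≤ 1 := by norm_num
  have hb2 : (2 * σ) ^ 3 * ∫ x, χ x ≤ 1 := by
    calc (2 * σ) ^ 3 * ∫ x, χ x = 8 * (σ ^ 3 * ∫ x, χ x) := by ring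
      _ ≤ 8 * ((1 / 64) * (1 / 8)) := by
          gcongr 8 * ?_
          exact mul_le_mul hσ364 hB1 hB0.le (by norm_num)
      _ ≤ 1 := by norm_num
  have heq' : (0 : ℝ) = σ ^ 3 * (∫ x, χ x) - (2 * σ) ^ 3 * ∫ x, χ x :=
    calc (0 : ℝ) = clip1 (σ ^ 3 * ∫ x, χ x * (fun _ : T3 => (1 : ℝ)) x) -
        clip1 ((2 * σ) ^ 3 * ∫ x, χ x * (fun _ : T3 => (1 : ℝ)) x) := heq
      _ = σ ^ 3 * (∫ x, χ x) - (2 * σ) ^ 3 * ∫ x, χ x := by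
          rw [hI, clip1_of_mem hb0 hb1, clip1_of_mem (by positivity) hb2]
  exact seven_sigma_cube_ne hσ hB0 heq'

/-! ### §4 The refutation of the density-agreement-dropped variant -/

/-- **The crux without REDUCED-DENSITY agreement is false** (`[load-bearing: ρσ³-agreement]`). Verbatim
`RelayRaceLocality.LightConeInLaw`, except that the agreement clause on the ball `B(x₀, R)` only ties velocities and
temperatures (`U₁ 0 x = U₂ 0 x ∧ Θ₁ 0 x = Θ₂ 0 x`; the conjunct `ρ₁ 0 x * σ₁ ^ 3 = ρ₂ 0 x * σ₂ ^ 3` is dropped).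
Witness: `M = 2`; both profiles `(1, 0, 1)`; `σ₁ = σ`, `σ₂ = 2σ`, `n₂ N = 8N + 8` (the eightfold gas of §1, constant
Euler states at both reduced diameters, `T₁ = T₂ = 2`); `t = 1`, `x₀ = 0`, `R = c + 1/8`, `χ` the bump of
`exists_coneBump`: the two homogeneous gases agree everywhere in `(U, Θ) = (0, 1)` and the guards hold
(`σ³, 8σ³ < η₀`), but they do not merge (`eight_not_merging`). [folklore] -/
theorem lightConeInLaw_false_without_densityAgreement :

    ¬ (open Literature.MathematicalPhysics.KineticTheory Literature.Analysis.FluidPDE MeasureTheory Filter in ∃ η₀ : ℝ, 0 < η₀ ∧ ∀ M : ℝ, 0 < M → ∃ c : ℝ, 0 < c ∧ ∀ (a₁ θ₁ a₂ θ₂ : T3 → ℝ) (u₁ u₂ : T3 → V3), Continuous a₁ → Continuous θ₁ → Continuous u₁ → Continuous a₂ → Continuous θ₂ → Continuous u₂ → (∀ x, 0 < a₁ x) → (∀ x, 0 < θ₁ x) → (∀ x, 0 < a₂ x) → (∀ x, 0 < θ₂ x) → ∃ σ₀ : ℝ, 0 < σ₀ ∧ ∀ (σ₁ σ₂ : ℝ),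 0 < σ₁ → σ₁ < σ₀ → 0 < σ₂ → σ₂ < σ₀ → ∀ n₂ : ℕ → ℕ, Tendsto (fun N => (n₂ N : ℝ) * hsDiameter σ₁ N ^ 3) atTop (nhds (σ₂ ^ 3)) → ∀ (T₁ T₂ : ℝ) (ρ₁ Θ₁ ρ₂ Θ₂ : ℝ → T3 → ℝ) (U₁ U₂ : ℝ → T3 → V3), IsHardSphereEulerSolution σ₁ T₁ ρ₁ U₁ Θ₁ → IsHardSphereEulerSolution σ₂ T₂ ρ₂ U₂ Θ₂ → ∀ (Φ₁ : (N : ℕ) → HardSphereFlow (Torus.geometry (Fin 3)) (hsDiameter σ₁ N) (N + 1)) (Φ₂ : (N : ℕ) → HardSphereFlow (Torus.geometry (Fin 3)) (hsDiameter σ₁ N) (n₂ N)), let P₁ : (N : ℕ) → Measure (Config (N + 1) (Fin 3) T3) := fun N => localGibbsLaw σ₁ a₁ u₁ θ₁ N (Φ₁ N); let P₂ : (N : ℕ) → Measure (Config (n₂ N) (Fin 3) T3) := fun N => particleLaw (Φ₂ N) (canonicalDensity (Torus.geometry (Fin 3)) (hsDiameter σ₁ N) (n₂ N) (localGibbsProfile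 a₂ u₂ θ₂)); (∀ N, IsProbabilityMeasure (P₁ N)) → (∀ N, IsProbabilityMeasure (P₂ N)) → TendstoHydroFieldsAt P₁ Φ₁ ρ₁ U₁ Θ₁ 0 → (∀ χ : T3 → ℝ, Continuous χ → ∀ δ : ℝ, 0 < δ → Tendsto (fun N => P₂ N {z | δ < |empiricalDensityField ((Φ₂ N).flow 0 z) χ - ∫ x, χ x * ρ₂ 0 x|}) atTop (nhds 0) ∧ Tendsto (fun N => P₂ N {z | δ < ‖empiricalMomentumField ((Φ₂ N).flow 0 z) χ - ∫ x, (χ x * ρ₂ 0 x) • U₂ 0 x‖}) atTop (nhds 0) ∧ Tendsto (fun N => P₂ N {z | δ < |empiricalEnergyField ((Φ₂ N).flow 0 z) χ - ∫ x, χ x * totalEnergyDensity (ρ₂ 0 x) (U₂ 0 x) (Θ₂ 0 x)|}) atTop (nhds 0)) → ∀ t : ℝ, 0 ≤ t → t < T₁ → t < T₂ → (∀ s ∈ Set.Icc 0 t, ∀ x, ρ₁ s x * σ₁ ^ 3 < η₀ ∧ Θ₁ s x ≤ M ∧ ‖U₁ s x‖ ≤ M ∧ ρ₂ s x * σ₂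 ^ 3 < η₀ ∧ Θ₂ s x ≤ M ∧ ‖U₂ s x‖ ≤ M) → ∀ (x₀ : T3) (R : ℝ), (∀ x, Torus.euclidDist x x₀ < R → U₁ 0 x = U₂ 0 x ∧ Θ₁ 0 x = Θ₂ 0 x) → ∀ χ : T3 → ℝ, Continuous χ → (∀ x, R - c * t ≤ Torus.euclidDist x x₀ → χ x = 0) → ∀ F : ℝ × V3 × ℝ → ℝ, LipschitzWith 1 F → (∀ p, |F p| ≤ 1) → Tendsto (fun N => (∫ z, F (σ₁ ^ 3 * empiricalDensityField ((Φ₁ N).flow t z) χ, (σ₁ ^ 3) • empiricalMomentumField ((Φ₁ N).flow t z) χ, σ₁ ^ 3 * empiricalEnergyField ((Φ₁ N).flow t z) χ) ∂(P₁ N)) - ∫ z, F (σ₂ ^ 3 * empiricalDensityField ((Φ₂ N).flow t z) χ, (σ₂ ^ 3) • empiricalMomentumField ((Φ₂ N).flow t z) χ, σ₂ ^ 3 * empiricalEnergyField ((Φ₂ N).flow t z) χ) ∂(P₂ N)) atTop (nhds 0)) := by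
  rintro ⟨η₀, hη₀, H⟩
  obtain ⟨χ, hχ, -, hχ8, hχint, hχsupp⟩ := exists_coneBump
  obtain ⟨σA, hσA, HA⟩ := homogeneous_lln_all_times one_pos (0 : V3)
  obtain ⟨σB, hσB, HB⟩ := eightLaw_lln_zero
  obtain ⟨c, hc, Hc⟩ := H 2 two_pos
  obtain ⟨σ₀, hσ₀, Hσ⟩ := Hc (fun _ => 1) (fun _ => 1) (fun _ => 1) (fun _ => 1) (fun _ => 0) (fun _ => 0)
    continuous_const continuous_const continuous_const continuous_const continuous_const continuous_const
    (fun _ => one_pos) (fun _ => one_pos) (fun _ => one_pos) (fun _ => one_pos)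
  obtain ⟨σ, hσ, h0, hA, hB, h4, hη, -⟩ :=
    exists_small (σ₀ / 2) σA σB (1 / 4) (η₀ / 8) 1 (by positivity) hσA hσB (by norm_num) (by positivity) one_pos
  have hσ4 : σ ≤ 1 / 4 := h4.le
  have hσhalf : σ < 1 / 2 := by linarith
  have hσ3le : σ ^ 3 ≤ σ := by
    have h : σ ^ 2 ≤ 1 := by nlinarith
    nlinarith
  have hσ3η : σ ^ 3 < η₀ := by linarith
  have h2σ3η : (2 * σ) ^ 3 < η₀ := by nlinarith
  obtain ⟨Φ₁⟩ := PolynomialCompressionPDE.flows_nonempty hσ hσhalf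
  obtain ⟨Φ₂⟩ := eightFlows_nonempty hσ hσhalf
  have hE₁ := constSol σ (0 : V3) one_pos
  have hE₂ := constSol (2 * σ) (0 : V3) one_pos
  have hP₁ : ∀ N, IsProbabilityMeasure (localGibbsLaw σ (fun _ => 1) (fun _ => (0 : V3)) (fun _ => 1) N (Φ₁ N)) :=
    isProb_homogeneous hσhalf 0 one_pos Φ₁
  have hP₂ : ∀ N, IsProbabilityMeasure (particleLaw (Φ₂ N) (canonicalDensity G3 (hsDiameter σ N) (8 * N + 7 + 1)
      (localGibbsProfile (fun _ : T3 => (1 : ℝ)) (fun _ : T3 => (0 : V3)) (fun _ : T3 => (1 : ℝ))))) := fun N => isProb_eightLaw hσ hσ4 N (Φ₂ N)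
  have hL₂ := HB σ hσ hB Φ₂
  have hL₁ : LLNAt (fun N => N + 1) (fun N => localGibbsLaw σ (fun _ => 1) (fun _ => (0 : V3)) (fun _ => 1) N (Φ₁ N))
      Φ₁ (fun _ => (1 : ℝ)) (fun _ => (0 : V3)) (fun _ => (1 : ℝ)) 1 :=
    (tendstoHydroFieldsAt_iff_LLNAt (fun N => localGibbsLaw σ (fun _ => 1) (fun _ => (0 : V3)) (fun _ => 1) N (Φ₁ N))
      Φ₁ (fun _ _ => (1 : ℝ)) (fun _ _ => (0 : V3)) (fun _ _ => (1 : ℝ)) 1).1 (HA σ hσ hA Φ₁ 1)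
  have h := Hσ σ (2 * σ) hσ (by linarith) (by positivity) (by linarith) (fun N => 8 * N + 7 + 1)
    (tendsto_eightfold_mul_hsDiameter σ) 2 2
    (fun _ _ => 1) (fun _ _ => 1) (fun _ _ => 1) (fun _ _ => 1) (fun _ _ => 0) (fun _ _ => 0) hE₁ hE₂ Φ₁ Φ₂
    hP₁ hP₂ (HA σ hσ hA Φ₁ 0) hL₂ 1 zero_le_one one_lt_two one_lt_two
    (fun s _ x => ⟨by simpa using hσ3η, by norm_num, by simp, by simpa using h2σ3η, by norm_num, by simp⟩)
    0 (c * 1 + 1 / 8) (fun x _ => ⟨rfl, rfl⟩) χ hχ (fun x hx => hχsupp x (by linarith))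
  exact eight_not_merging hσ hσ4 hχ hχ8 hχint Φ₁ Φ₂ hP₁ hP₂ hL₁ hL₂ h

/-! ### §5 The same clause is load-bearing for the line's `stub_cone` (R2, commensurate comparison number) -/

/-- **`stub_cone` (line `susceptibility-variance-continuity`, R2: the crux with `n₂ N = ⌈(σ₂/σ₁)³(N+1)⌉₊` pinned)
without REDUCED-DENSITY agreement is FALSE** — a formally stronger statement than
`lightConeInLaw_false_without_densityAgreement` (R2 is weaker than the crux), by the SAME witness: the eightfold gas
IS commensurate, `8N + 8 = ⌈(2σ/σ)³ (N+1)⌉₊`. So the lead's stub keeps this clause for cause. [folklore] -/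
theorem stubCone_false_without_densityAgreement :
    ¬ (∃ η₀ : ℝ, 0 < η₀ ∧ ∀ M : ℝ, 0 < M → ∃ c : ℝ, 0 < c ∧ ∀ (a₁ θ₁ a₂ θ₂ : T3 → ℝ) (u₁ u₂ : T3 → V3), Continuous a₁ → Continuous θ₁ → Continuous u₁ → Continuous a₂ → Continuous θ₂ → Continuous u₂ → (∀ x, 0 < a₁ x) → (∀ x, 0 < θ₁ x) → (∀ x, 0 < a₂ x) → (∀ x, 0 < θ₂ x) → ∃ σ₀ : ℝ, 0 < σ₀ ∧ ∀ (σ₁ σ₂ : ℝ), 0 < σ₁ → σ₁ < σ₀ → 0 < σ₂ → σ₂ < σ₀ → ∀ n₂ : ℕ → ℕ, (∀ N, n₂ N = ⌈(σ₂ / σ₁) ^ 3 * ((N + 1 : ℕ) : ℝ)⌉₊) → ∀ (T₁ T₂ : ℝ) (ρ₁ Θ₁ ρ₂ Θ₂ : ℝ → T3 → ℝ) (U₁ U₂ : ℝ → T3 → V3), IsHardSphereEulerSolution σ₁ T₁ ρ₁ U₁ Θ₁ → IsHardSphereEulerSolution σ₂ T₂ ρ₂ U₂ Θ₂ → ∀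 (Φ₁ : (N : ℕ) → HardSphereFlow (Torus.geometry (Fin 3)) (hsDiameter σ₁ N) (N + 1)) (Φ₂ : (N : ℕ) → HardSphereFlow (Torus.geometry (Fin 3)) (hsDiameter σ₁ N) (n₂ N)), let P₁ : (N : ℕ) → Measure (Config (N + 1) (Fin 3) T3) := fun N => localGibbsLaw σ₁ a₁ u₁ θ₁ N (Φ₁ N); let P₂ : (N : ℕ) → Measure (Config (n₂ N) (Fin 3) T3) := fun N => particleLaw (Φ₂ N) (canonicalDensity (Torus.geometry (Fin 3)) (hsDiameter σ₁ N) (n₂ N) (localGibbsProfile a₂ u₂ θ₂)); (∀ N, IsProbabilityMeasure (P₁ N)) → (∀ N, IsProbabilityMeasure (P₂ N)) → TendstoHydroFieldsAt P₁ Φ₁ ρ₁ U₁ Θ₁ 0 → (∀ χ : T3 → ℝ, Continuous χ → ∀ δ : ℝ, 0 < δ → Tendsto (fun N => P₂ N {z | δ < |empiricalDensityField ((Φ₂ N).flow 0 z) χ - ∫ x, χ x * ρ₂ 0 x|}) atTop (nhds 0) ∧ Tendsto (fun N => P₂ N {z | δ < ‖empiricalMomentumField ((Φ₂ N).flow 0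 z) χ - ∫ x, (χ x * ρ₂ 0 x) • U₂ 0 x‖}) atTop (nhds 0) ∧ Tendsto (fun N => P₂ N {z | δ < |empiricalEnergyField ((Φ₂ N).flow 0 z) χ - ∫ x, χ x * totalEnergyDensity (ρ₂ 0 x) (U₂ 0 x) (Θ₂ 0 x)|}) atTop (nhds 0)) → ∀ t : ℝ, 0 ≤ t → t < T₁ → t < T₂ → (∀ s ∈ Set.Icc 0 t, ∀ x, ρ₁ s x * σ₁ ^ 3 < η₀ ∧ Θ₁ s x ≤ M ∧ ‖U₁ s x‖ ≤ M ∧ ρ₂ s x * σ₂ ^ 3 < η₀ ∧ Θ₂ s x ≤ M ∧ ‖U₂ s x‖ ≤ M) → ∀ (x₀ : T3) (R : ℝ), (∀ x, Torus.euclidDist x x₀ < R → U₁ 0 x = U₂ 0 x ∧ Θ₁ 0 x = Θ₂ 0 x) → ∀ χ : T3 → ℝ, Continuous χ → (∀ x, R - c * t ≤ Torus.euclidDist x x₀ → χ x = 0) → ∀ F : ℝ × V3 × ℝ → ℝ, LipschitzWith 1 F → (∀ p, |F p| ≤ 1) → Tendsto (fun N => (∫ z, F (σ₁ ^ 3 *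 empiricalDensityField ((Φ₁ N).flow t z) χ, (σ₁ ^ 3) • empiricalMomentumField ((Φ₁ N).flow t z) χ, σ₁ ^ 3 * empiricalEnergyField ((Φ₁ N).flow t z) χ) ∂(P₁ N)) - ∫ z, F (σ₂ ^ 3 * empiricalDensityField ((Φ₂ N).flow t z) χ, (σ₂ ^ 3) • empiricalMomentumField ((Φ₂ N).flow t z) χ, σ₂ ^ 3 * empiricalEnergyField ((Φ₂ N).flow t z) χ) ∂(P₂ N)) atTop (nhds 0)) := by
  rintro ⟨η₀, hη₀, H⟩
  obtain ⟨χ, hχ, -, hχ8, hχint, hχsupp⟩ := exists_coneBump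
  obtain ⟨σA, hσA, HA⟩ := homogeneous_lln_all_times one_pos (0 : V3)
  obtain ⟨σB, hσB, HB⟩ := eightLaw_lln_zero
  obtain ⟨c, hc, Hc⟩ := H 2 two_pos
  obtain ⟨σ₀, hσ₀, Hσ⟩ := Hc (fun _ => 1) (fun _ => 1) (fun _ => 1) (fun _ => 1) (fun _ => 0) (fun _ => 0)
    continuous_const continuous_const continuous_const continuous_const continuous_const continuous_const
    (fun _ => one_pos) (fun _ => one_pos) (fun _ => one_pos) (fun _ => one_pos)
  obtain ⟨σ, hσ, h0, hA, hB, h4, hη, -⟩ :=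
    exists_small (σ₀ / 2) σA σB (1 / 4) (η₀ / 8) 1 (by positivity) hσA hσB (by norm_num) (by positivity) one_pos
  have hσ4 : σ ≤ 1 / 4 := h4.le
  have hσhalf : σ < 1 / 2 := by linarith
  have hσ3le : σ ^ 3 ≤ σ := by
    have h : σ ^ 2 ≤ 1 := by nlinarith
    nlinarith
  have hσ3η : σ ^ 3 < η₀ := by linarith
  have h2σ3η : (2 * σ) ^ 3 < η₀ := by nlinarith
  have hceil : ∀ N : ℕ, 8 * N + 7 + 1 = ⌈(2 * σ / σ) ^ 3 * ((N + 1 : ℕ) : ℝ)⌉₊ := by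
    intro N
    rw [mul_div_assoc, div_self hσ.ne', mul_one,
      show (2 : ℝ) ^ 3 * ((N + 1 : ℕ) : ℝ) = ((8 * N + 7 + 1 : ℕ) : ℝ) by push_cast; ring, Nat.ceil_natCast]
  obtain ⟨Φ₁⟩ := PolynomialCompressionPDE.flows_nonempty hσ hσhalf
  obtain ⟨Φ₂⟩ := eightFlows_nonempty hσ hσhalf
  have hE₁ := constSol σ (0 : V3) one_pos
  have hE₂ := constSol (2 * σ) (0 : V3) one_pos
  have hP₁ : ∀ N, IsProbabilityMeasure (localGibbsLaw σ (fun _ => 1) (fun _ => (0 : V3)) (fun _ => 1) N (Φ₁ N)) :=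
    isProb_homogeneous hσhalf 0 one_pos Φ₁
  have hP₂ : ∀ N, IsProbabilityMeasure (particleLaw (Φ₂ N) (canonicalDensity G3 (hsDiameter σ N) (8 * N + 7 + 1)
      (localGibbsProfile (fun _ : T3 => (1 : ℝ)) (fun _ : T3 => (0 : V3)) (fun _ : T3 => (1 : ℝ))))) := fun N =>
    isProb_eightLaw hσ hσ4 N (Φ₂ N)
  have hL₂ := HB σ hσ hB Φ₂
  have hL₁ : LLNAt (fun N => N + 1) (fun N => localGibbsLaw σ (fun _ => 1) (fun _ => (0 : V3)) (fun _ => 1) N (Φ₁ N))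
      Φ₁ (fun _ => (1 : ℝ)) (fun _ => (0 : V3)) (fun _ => (1 : ℝ)) 1 :=
    (tendstoHydroFieldsAt_iff_LLNAt (fun N => localGibbsLaw σ (fun _ => 1) (fun _ => (0 : V3)) (fun _ => 1) N (Φ₁ N))
      Φ₁ (fun _ _ => (1 : ℝ)) (fun _ _ => (0 : V3)) (fun _ _ => (1 : ℝ)) 1).1 (HA σ hσ hA Φ₁ 1)
  have h := Hσ σ (2 * σ) hσ (by linarith) (by positivity) (by linarith) (fun N => 8 * N + 7 + 1) hceil 2 2
    (fun _ _ => 1) (fun _ _ => 1) (fun _ _ => 1) (fun _ _ => 1) (fun _ _ => 0) (fun _ _ => 0) hE₁ hE₂ Φ₁ Φ₂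
    hP₁ hP₂ (HA σ hσ hA Φ₁ 0) hL₂ 1 zero_le_one one_lt_two one_lt_two
    (fun s _ x => ⟨by simpa using hσ3η, by norm_num, by simp, by simpa using h2σ3η, by norm_num, by simp⟩)
    0 (c * 1 + 1 / 8) (fun x _ => ⟨rfl, rfl⟩) χ hχ (fun x hx => hχsupp x (by linarith))
  exact eight_not_merging hσ hσ4 hχ hχ8 hχint Φ₁ Φ₂ hP₁ hP₂ hL₁ hL₂ h

end LightConeInLawNegative

end Summit.AtomisticToContinuum.HydrodynamicLimit.Theorems

end
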